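import Mathlib

/-!
# NegationLens6g11 — algebraic spines of NEGATION-lens6-g11.md (lens 6, g11)

Bears on LADDER-RESOLUTION:B only through crux 15917 `CleanModels`, stub 4e; [OURS · CANDIDATE] counted 0.
Nothing here proves resolution of singularities in characteristic `p`; crux 0549 is neither
restated nor proved.  Pure commutative algebra / arithmetic, `import Mathlib` only.

* K5  non-degeneracy of the (B2) critical point: for `F = α s^λ + β s^(λ+1)` (λ = n+2 ≥ 2), with
      `F₁, F₂` its term-wise first/second formal derivatives, the ring identity
      `s·F₂ = (λ−1)·F₁ + (λ+1)·β·s^λ`, the evaluated consequence `F₁(c) = 0 → c·F₂(c) = (λ+1)·β·c^λ`,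
      hence `F₂(c) ≠ 0` when `c, β, λ+1 ≠ 0`, and `c = −λα/((λ+1)β)`; the case λ = 1 is `F₂ = 2β`.
* K6  three poles `0, 1, ∞` with residues `a, b, −(a+b)`: the zero of `a/s + b/(s−1)` is the
      `F_p`-rational point `s = a/(a+b)`.
* K7  the node-round ladder: an odd prime dividing `2(j+1)` divides `j+1`.
* K8  the residue reset: `1 ≤ λ₁, λ₂ ≤ p−1`, `p ∣ λ₁+λ₂+1` ⇒ `λ₁+λ₂+1 = p` (so the (M2) division is `k = 1`
      and `λ₂ ≤ p−2`, i.e. `λ₂+1 ≢ 0`).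
-/

namespace NegationLens6g11

section K5
variable {R : Type*} [CommRing R]

/-- K5 (ring form).  For `F(s) = α s^(n+2) + β s^(n+3)` (exponent `λ = n+2 ≥ 2`) write
`F₁(s) = (n+2) α s^(n+1) + (n+3) β s^(n+2)` and `F₂(s) = (n+2)(n+1) α s^n + (n+3)(n+2) β s^(n+1)`
for its first and second formal derivatives (term-wise power rule).  Then
`s·F₂(s) = (n+1)·F₁(s) + (n+3)·β·s^(n+2)` identically. -/
theorem K5_identity (α β s : R) (n : ℕ) :
    s * ((n + 2 : R) * (n + 1 : R) * α * s ^ n + (n + 3 : R) * (n + 2 : R) * β * s ^ (n + 1))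
      = (n + 1 : R) * ((n + 2 : R) * α * s ^ (n + 1) + (n + 3 : R) * β * s ^ (n + 2))
        + (n + 3 : R) * β * s ^ (n + 2) := by
  ring

/-- K5 evaluated: at a critical point `c` of `F` (`F₁(c) = 0`), `c·F₂(c) = (λ+1)·β·c^λ`. -/
theorem K5_eval (α β c : R) (n : ℕ)
    (hc : (n + 2 : R) * α * c ^ (n + 1) + (n + 3 : R) * β * c ^ (n + 2) = 0) :
    c * ((n + 2 : R) * (n + 1 : R) * α * c ^ n + (n + 3 : R) * (n + 2 : R) * β * c ^ (n + 1))
      = (n + 3 : R) * β * c ^ (n + 2) := by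
  rw [K5_identity, hc]; ring

/-- K5, case `λ = 1`: `F = α s + β s²` has `F₂ = 2β`, non-zero once `2 ≠ 0` and `β ≠ 0`. -/
theorem K5_lambda_one {K : Type*} [Field K] (β : K) (h2 : (2 : K) ≠ 0) (hβ : β ≠ 0) :
    (2 : K) * β ≠ 0 := mul_ne_zero h2 hβ

/-- Consequence used in Lemma B(i): in a field, at a critical point `c ≠ 0` with `β ≠ 0` and
`λ + 1 = n + 3 ≠ 0` in the field, the second derivative `F₂(c)` does not vanish. -/
theorem K5_nondegenerate {K : Type*} [Field K] (α β c : K) (n : ℕ)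
    (hc : (n + 2 : K) * α * c ^ (n + 1) + (n + 3 : K) * β * c ^ (n + 2) = 0)
    (hc0 : c ≠ 0) (hβ : β ≠ 0) (hl : (n + 3 : K) ≠ 0) :
    (n + 2 : K) * (n + 1 : K) * α * c ^ n + (n + 3 : K) * (n + 2 : K) * β * c ^ (n + 1) ≠ 0 := by
  intro h0
  have h := K5_eval α β c n hc
  rw [h0, mul_zero] at h
  have : (n + 3 : K) * β * c ^ (n + 2) ≠ 0 := mul_ne_zero (mul_ne_zero hl hβ) (pow_ne_zero _ hc0)
  exact this h.symm

/-- The critical point itself: `F₁(c) = 0`, `c ≠ 0` ⇒ `(n+2)·α + (n+3)·β·c = 0`, i.e.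
`c = -(λ α)/((λ+1) β)` — the point `s_c` of the memo ((R-d)/(B2)). -/
theorem K5_critical_point {K : Type*} [Field K] (α β c : K) (n : ℕ)
    (hc : (n + 2 : K) * α * c ^ (n + 1) + (n + 3 : K) * β * c ^ (n + 2) = 0) (hc0 : c ≠ 0)
    (hβ : β ≠ 0) (hl : (n + 3 : K) ≠ 0) :
    c = -((n + 2 : K) * α) / ((n + 3 : K) * β) := by
  have hpow : c ^ (n + 1) ≠ 0 := pow_ne_zero _ hc0
  have hlin : (n + 2 : K) * α + (n + 3 : K) * β * c = 0 := by
    have : c ^ (n + 1) * ((n + 2 : K) * α + (n + 3 : K) * β * c) = 0 := by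
      rw [← hc]; ring
    rcases mul_eq_zero.mp this with h | h
    · exact absurd h hpow
    · exact h
  rw [eq_div_iff (mul_ne_zero hl hβ)]
  linear_combination hlin

end K5

section K6
variable {K : Type*} [Field K]

/-- K6: the unique zero of `a/s + b/(s-1)` off the poles is the `F_p`-rational point `a/(a+b)`. -/
theorem K6_three_pole_zero (a b s : K) (hs : s ≠ 0) (hs1 : s ≠ 1) (hab : a + b ≠ 0) :
    a / s + b / (s - 1) = 0 ↔ s = a / (a + b) := by
  have h1 : s - 1 ≠ 0 := sub_ne_zero.mpr hs1
  rw [div_add_div _ _ hs h1, div_eq_zero_iff, eq_div_iff hab]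
  constructor
  · rintro (h | h)
    · linear_combination h
    · exact absurd h (mul_ne_zero hs h1)
  · intro h
    left
    linear_combination h

end K6

section K7K8

/-- K7: the node-round residue ladder `(1, 2j) ↦ 2j+2` meets `≡ 0 (mod p)` only when `p ∣ j+1`. -/
theorem K7_odd_prime_dvd (p j : ℕ) (hp : p.Prime) (hodd : p ≠ 2) (h : p ∣ 2 * (j + 1)) :
    p ∣ j + 1 := by
  rcases (Nat.Prime.dvd_mul hp).mp h with h2 | h2
  · exact absurd ((Nat.prime_dvd_prime_iff_eq hp Nat.prime_two).mp h2) hodd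
  · exact h2

/-- K8: the residue reset at a (B2) corner birth: the order is exactly `p` (one (M2) division)
and `λ₂ ≤ p - 2`. -/
theorem K8_residue_reset (p l₁ l₂ : ℕ) (hp : 2 ≤ p) (h₁ : 1 ≤ l₁) (h₁' : l₁ ≤ p - 1)
    (_h₂ : 1 ≤ l₂) (_h₂' : l₂ ≤ p - 1) (hd : p ∣ l₁ + l₂ + 1) :
    l₁ + l₂ + 1 = p ∧ l₂ ≤ p - 2 := by
  obtain ⟨k, hk⟩ := hd
  have hk0 : 0 < k := by
    rcases Nat.eq_zero_or_pos k with h | h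
    · simp [h] at hk
    · exact h
  have hk2 : k < 2 := by
    by_contra hcon
    have hcon' : 2 ≤ k := Nat.le_of_not_lt hcon
    have : p * 2 ≤ p * k := Nat.mul_le_mul_left p hcon'
    omega
  interval_cases k
  omega

end K7K8

/-! ### K9–K10 (rev 1.2, memo §2.8): the residue obstruction behind Theorem E4.
K9: along a delivered leaf's corridor the lines have residues in `{0, 1}`; a delivery-line event needs a
line of residue `p - 1`; for `p ≥ 3` these never meet.  K10: the two arrival residues — at the corner
`x_{s+1} = n ∩ ℓ'` (residues `0`, `p-1`) with the creating leaf (`+1`) the new plane has residue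
`(0 + (p-1) + 1) % p = 0`, and with a delivery already present (`+1` more) residue `1`. -/
section K9K10

theorem K9_corridor_obstruction (p : ℕ) (hp : 3 ≤ p) :
    (p - 1) % p ≠ 0 ∧ (p - 1) % p ≠ 1 := by
  have h : (p - 1) % p = p - 1 := Nat.mod_eq_of_lt (by omega)
  rw [h]; omega

theorem K10_arrival_residues (p : ℕ) (hp : 3 ≤ p) :
    (0 + (p - 1) + 1) % p = 0 ∧ (0 + (p - 1) + 1 + 1) % p = 1 := by
  have h1 : 0 + (p - 1) + 1 = p := by omega
  have h2 : 0 + (p - 1) + 1 + 1 = p + 1 := by omega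
  refine ⟨by rw [h1, Nat.mod_self], ?_⟩
  rw [h2, Nat.add_mod_left]
  exact Nat.mod_eq_of_lt (by omega)

/-- The division-invariance bookkeeping used in (E2): a non-leaf line's plane residue `l` is unchanged by
its own division (`o(η) = l + 0`), while a line inside one tracked leaf (`g = 1`) gains `1`; starting from
the arrival set `{0,1}` a non-leaf corridor therefore never reaches `p - 1` (K9). -/
theorem K10_nonleaf_invariant (l : ℕ) : l + 0 = l := Nat.add_zero l

/-! ### K9b (rev 1.4, answer to crit-1 Q-res2): with at most ONE residue gain per corridor line (a line lies in
at most one tracked leaf and, absent osculation, is divided at most once while inside it) the corridor residues lie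
in `{0,1,2}`; for `p ≥ 5` this still misses `p - 1`.  (For `p = 3`, `2 = p - 1` and the memo's (E5) excludes the
event by transversality of every present leaf to the gained line.) -/
theorem K9b_stacked_corridor (p : ℕ) (hp : 5 ≤ p) :
    (p - 1) % p ≠ 0 ∧ (p - 1) % p ≠ 1 ∧ (p - 1) % p ≠ 2 := by
  have h : (p - 1) % p = p - 1 := Nat.mod_eq_of_lt (by omega)
  rw [h]; omega

theorem K9b_p3_gained_residue : (1 + 1) % 3 = 3 - 1 := by decide

end K9K10

/-! ### K11 (rev 1.5, memo §2.10 Jet Lemma F): the algebraic core.  In characteristic `p` the derivative of a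
polynomial of degree `≤ p*c` has degree `≤ p*c - 2` (the top coefficient `p*c` dies), so if it vanishes to
order `≥ p*c - 1` at a point it is identically zero, and then the polynomial is a polynomial in `X^p`
(`expand_contract`) — over a perfect field a `p`-th power: the tower top is W-invariant and carries no birth. -/


section K11
open Polynomial
variable {K : Type*} [Field K] (p : ℕ) [Fact p.Prime] [CharP K p]

/-- K11a: in characteristic `p`, the coefficient of `X^(p*c-1)` in the derivative of any polynomial vanishes. -/
theorem K11_coeff_derivative_top (f : K[X]) (c : ℕ) (hc : 1 ≤ c) :
    (derivative f).coeff (p * c - 1) = 0 := by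
  rw [coeff_derivative]
  have h1 : p * c - 1 + 1 = p * c := by
    have : 1 ≤ p * c := by
      have hp : 1 ≤ p := (Fact.out : p.Prime).one_lt.le
      nlinarith
    omega
  rw [h1]
  have : ((p * c : ℕ) : K) = 0 := by
    rw [Nat.cast_mul, CharP.cast_eq_zero K p, zero_mul]
  have h2 : ((p * c - 1 : ℕ) : K) + 1 = ((p * c : ℕ) : K) := by
    rw [← h1]; push_cast; ring
  rw [h2, this, mul_zero]

/-- K11b: hence if `natDegree f ≤ p*c` then `natDegree (derivative f) ≤ p*c - 2`. -/
theorem K11_natDegree_derivative_le (f : K[X]) (c : ℕ) (hc : 1 ≤ c) (hf : f.natDegree ≤ p * c) :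
    (derivative f).natDegree ≤ p * c - 2 := by
  have hp2 : 2 ≤ p := (Fact.out : p.Prime).two_le
  have hpc : 2 ≤ p * c := by nlinarith
  rw [Polynomial.natDegree_le_iff_coeff_eq_zero]
  intro n hn
  by_cases h : n = p * c - 1
  · subst h; exact K11_coeff_derivative_top p f c hc
  · rw [coeff_derivative]
    have hn' : p * c < n + 1 := by omega
    have : f.coeff (n + 1) = 0 := by
      apply Polynomial.coeff_eq_zero_of_natDegree_lt
      omega
    rw [this, zero_mul]

/-- K11c (the jet lemma's algebraic core): if moreover `(X - a)^(p*c-1)` divides the derivative, the derivative is zero. -/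
theorem K11_derivative_eq_zero (f : K[X]) (c : ℕ) (hc : 1 ≤ c) (hf : f.natDegree ≤ p * c) (a : K)
    (hdvd : (X - C a) ^ (p * c - 1) ∣ derivative f) : derivative f = 0 := by
  by_contra hne
  have hdeg := K11_natDegree_derivative_le p f c hc hf
  have hp2 : 2 ≤ p := (Fact.out : p.Prime).two_le
  have hpc : 2 ≤ p * c := by nlinarith
  have h1 : ((X - C a) ^ (p * c - 1)).natDegree = p * c - 1 := by
    rw [natDegree_pow, natDegree_X_sub_C, mul_one]
  have h2 := Polynomial.natDegree_le_of_dvd hdvd hne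
  rw [h1] at h2
  omega

end K11

section K11d
open Polynomial
variable {K : Type*} [Field K] (p : ℕ) [hp : Fact p.Prime] [CharP K p]
/-- K11d: and a polynomial with zero derivative in characteristic `p` is a polynomial in `X^p`
(so over a perfect field it is a `p`-th power: the tower top is W-invariant, no birth). -/
theorem K11_deriv_zero_expand (f : K[X]) (hf : derivative f = 0) :
    expand K p (contract p f) = f :=
  expand_contract p hf hp.out.ne_zero
end K11d

end NegationLens6g11
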